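import Mathlib

/-!
# M3 (ii-c): the pair-susceptibility moment inequality — abstract core

HONEST FRAMING: first certified bounds; not a superconductivity verdict; every number
certified or labelled float.

Speedrun `mbsolver`, M3 canonical point (U = 8t, n = 7/8, t′ ∈ {0, −1/4}); operator seat
sr-mbsolver-m3-1, `run/shared/lean/speedrun/mbsolver/sr-mbsolver-m3-1/M3-OPERATORS.md` §3.

Dictionary (finite torus, sector `(N, S^z = 0)`, ground state `ψ` of `H`, `K = H − μ′ N̂` with
`μ′` admissible): index the eigenvectors `n` of `H` in the sectors `N ± 2` by a finite type, put
`w n = |⟨n, Δ_d^* ψ⟩|²` (resp. `|⟨n, Δ_d ψ⟩|²`) and `ε n =` the `K`-excitation energy of `n`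
(`> 0` in the interior of the admissible `μ′`-interval).  Then
* `M₀  = Σ w      = ω_ψ(Δ_d Δ_d^* + Δ_d^* Δ_d)`            (test vectors `pairsusc_M0_*`),
* `M₁  = Σ w ε    = ω_ψ(D_h) − 2 μ′ ω_ψ([Δ_d, Δ_d^*])`      (`pairsusc_D_t/_D_tp/_D_U`, `pairsusc_C_*`),
* `M₋₁ = Σ w / ε  = N_s · χ_d(μ′)`                          (the T = 0 pair susceptibility).
The two theorems below are the only analysis a certified `chid` row needs on top of the SDP
windows `M0_lo ≤ M₀` and `M₁ ≤ M1_hi`: a LOWER bound `M0_lo² / M1_hi ≤ N_s χ_d(μ′)`.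
No upper bound on `χ_d` follows from equal-time data (it would need a gap) — none is claimed.
-/

namespace Summit.Ventures.CertifiedManyBodySolver.M3

open Finset

variable {ι : Type*}

/-- Cauchy–Schwarz for spectral moments: `(Σ w)² ≤ (Σ w/ε) · (Σ w ε)` for nonnegative weights
`w` and positive excitation energies `ε` (`M₀² ≤ M₋₁ M₁`). -/
theorem moment_sq_le_inv_moment_mul_first_moment (s : Finset ι) (w ε : ι → ℝ)
    (hw : ∀ i ∈ s, 0 ≤ w i) (hε : ∀ i ∈ s, 0 < ε i) :
    (∑ i ∈ s, w i) ^ 2 ≤ (∑ i ∈ s, w i / ε i) * ∑ i ∈ s, w i * ε i := by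
  refine Finset.sum_sq_le_sum_mul_sum_of_sq_le_mul s (r := w)
    (f := fun i => w i / ε i) (g := fun i => w i * ε i) ?_ ?_ ?_
  · intro i hi
    exact div_nonneg (hw i hi) (hε i hi).le
  · intro i hi
    exact mul_nonneg (hw i hi) (hε i hi).le
  · intro i hi
    have hne : ε i ≠ 0 := (hε i hi).ne'
    have : w i / ε i * (w i * ε i) = w i ^ 2 := by
      rw [div_mul_eq_mul_div, mul_comm (w i) (ε i), ← mul_assoc, div_eq_iff hne]
      ring
    rw [this]

/-- The certified-row form: from a certified lower bound `M0lo ≤ Σ w` (with `0 ≤ M0lo`) and a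
certified upper bound `Σ w ε ≤ M1hi` (with `0 < M1hi`), the susceptibility-type sum is bounded
below: `M0lo² / M1hi ≤ Σ w/ε`. -/
theorem inv_moment_ge_of_certified_bounds (s : Finset ι) (w ε : ι → ℝ)
    (hw : ∀ i ∈ s, 0 ≤ w i) (hε : ∀ i ∈ s, 0 < ε i)
    {M0lo M1hi : ℝ} (h0 : M0lo ≤ ∑ i ∈ s, w i) (h0nn : 0 ≤ M0lo)
    (h1 : ∑ i ∈ s, w i * ε i ≤ M1hi) (h1pos : 0 < M1hi) :
    M0lo ^ 2 / M1hi ≤ ∑ i ∈ s, w i / ε i := by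
  have hcs := moment_sq_le_inv_moment_mul_first_moment s w ε hw hε
  have hinv_nn : 0 ≤ ∑ i ∈ s, w i / ε i :=
    sum_nonneg fun i hi => div_nonneg (hw i hi) (hε i hi).le
  have hsq : M0lo ^ 2 ≤ (∑ i ∈ s, w i) ^ 2 := by
    exact pow_le_pow_left₀ h0nn h0 2
  have hchain : M0lo ^ 2 ≤ (∑ i ∈ s, w i / ε i) * M1hi :=
    hsq.trans (hcs.trans (mul_le_mul_of_nonneg_left h1 hinv_nn))
  rw [div_le_iff₀ h1pos]
  exact hchain

/-- Monotonicity in `μ′` used by the row recipe: `M₁(μ′) = D − 2 μ′ C` is affine in `μ′`, so an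
upper bound valid at both endpoints of an interval is valid on the whole interval. -/
theorem affine_le_of_le_endpoints {D C M1hi a b μ : ℝ} (hab : a ≤ μ ∧ μ ≤ b)
    (ha : D - 2 * a * C ≤ M1hi) (hb : D - 2 * b * C ≤ M1hi) :
    D - 2 * μ * C ≤ M1hi := by
  obtain ⟨haμ, hμb⟩ := hab
  rcases le_total 0 C with hC | hC
  · -- C ≥ 0: the expression is antitone in μ, so the value at μ is ≤ the value at a
    have : D - 2 * μ * C ≤ D - 2 * a * C := by nlinarith
    exact this.trans ha
  · -- C ≤ 0: monotone in μ, so the value at μ is ≤ the value at b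
    have : D - 2 * μ * C ≤ D - 2 * b * C := by nlinarith
    exact this.trans hb

end Summit.Ventures.CertifiedManyBodySolver.M3
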